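import Literature.NumberTheory.LFunctions.UniformClassGroupPNTTransfer
import HarnessLib

/-!
# Partial summation with an exceptional-zero term, II: the transfer theorem

Topic `Literature/NumberTheory/LFunctions` (namespace `Literature.NumberTheory.LFunctions`),
continuing `UniformClassGroupPNTTransfer.lean` (the secondary-term identity
`secondaryTerm_eq_offsetLogIntegral_add`, Thorner–Zaman (5.2), and the comparison of the main
terms `exists_exceptionalMainTerm_le`).  Everything here is PROVED (theorems only).

Main result `abs_sub_exceptionalLiMain_le`: if a Chebyshev-type function `T ≥ 0`, `T(t) ≤ B t`,
satisfies `|T(t) − g(t)/h| ≤ A E(t) g(t)/h` for `t ≥ y` with `g(t) = t − θ₁ t^β/β` (`|θ₁| ≤ 1`,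
`1/2 < β ≤ 1`, `E ≥ 0` non-increasing), then the partial-summation transform
`P = T(x)/log x + ∫₂ˣ T(t) dt/(t log² t)` satisfies, for `x ≥ max(256, y²)`,
`|P − G(x)/h| ≤ 30 A E(√x) G(x)/h + (3B + 19/h)√x` with `G(x) = Li(x) − θ₁ Li(x^β)` — the last
paragraph of the proof of [ThornerZaman2019, Thm. 5.1] ((5.2)–(5.3)), with absolute constants,
for an abstract `T` (there `ψ_C`; in the tree `θ_C = chebyshevThetaIdealClass` through
`primeIdealClassCount_eq_theta_div_log_add_integral`, or `ψ(x; q, a)` over `ℚ`).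

## References

* J. Thorner, A. Zaman, *A unified and improved Chebotarev density theorem*, Algebra Number
  Theory 13 (2019) 1039–1068, proof of Theorem 5.1, (5.2)–(5.3). [ThornerZaman2019]
-/

noncomputable section

open Real MeasureTheory Set Filter
open scoped Topology

namespace Literature.NumberTheory.LFunctions

/-! ### The transfer theorem -/

/-- Numerical: `s − 2 ≤ (21/10) s log² 2` for `s ≥ 0` (`log² 2 > 0.48 > 10/21`). [folklore] -/
theorem sub_two_le_mul_log_two_sq {s : ℝ} (hs : 0 ≤ s) :
    s - 2 ≤ 21 / 10 * s * Real.log 2 ^ 2 := by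
  have hlog2 : (0.6931471803 : ℝ) < Real.log 2 := Real.log_two_gt_d9
  have h1 : (10 : ℝ) / 21 ≤ Real.log 2 ^ 2 := by nlinarith
  have h2 := mul_le_mul_of_nonneg_left h1 (by positivity : (0 : ℝ) ≤ 21 / 10 * s)
  linarith

/-- Numerical bookkeeping of the junk terms: `(B + 3/h)(21/10)s + 12/h ≤ (3B + 19/h)s` for
`B ≥ 0`, `h > 0`, `s ≥ 1`. [folklore] -/
theorem junk_terms_le {B h s : ℝ} (hB : 0 ≤ B) (hh : 0 < h) (hs : 1 ≤ s) :
    (B + 3 / h) * (21 / 10 * s) + 12 / h ≤ (3 * B + 19 / h) * s := by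
  have h1 : 0 ≤ B * s := mul_nonneg hB (by linarith)
  have h2 : 12 / h ≤ 12 / h * s := le_mul_of_one_le_right (by positivity) hs
  have h3 : 0 ≤ s / h := by positivity
  have e1 : (B + 3 / h) * (21 / 10 * s) = 21 / 10 * (B * s) + 63 / 10 * (s / h) := by ring
  have e2 : (3 * B + 19 / h) * s = 3 * (B * s) + 19 * (s / h) := by ring
  have e3 : 12 / h * s = 12 * (s / h) := by ring
  rw [e1, e2]
  rw [e3] at h2
  linarith


/-- Continuity of `t ↦ (t − θ₁ t^β/β)/h/(t log² t)` at `t > 1`. [folklore] -/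
theorem continuousAt_exceptionalMainTerm_div (θ₁ β h : ℝ) {t : ℝ} (ht : 1 < t) :
    ContinuousAt (fun u : ℝ ↦ (u - θ₁ * u ^ β / β) / h / (u * Real.log u ^ 2)) t := by
  have ht0 : t ≠ 0 := by linarith
  have hlog : Real.log t ≠ 0 := Real.log_ne_zero_of_pos_of_ne_one (by linarith) (by linarith)
  have h1 : ContinuousAt (fun u : ℝ ↦ u ^ β) t := Real.continuousAt_rpow_const _ _ (Or.inl ht0)
  have h2 : ContinuousAt (fun u : ℝ ↦ u * Real.log u ^ 2) t :=
    continuousAt_id.mul ((Real.continuousAt_log ht0).pow 2)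
  exact ((continuousAt_id.sub ((h1.const_mul θ₁).div_const β)).div_const h).div h2
    (mul_ne_zero ht0 (pow_ne_zero _ hlog))

/-- **Transfer of a `θ`-type asymptotic with exceptional term to the counting function**
(Thorner–Zaman, proof of Theorem 5.1, last paragraph, with (5.2); the same step as
Montgomery–Vaughan's passage from `ψ(x; q, a)` to `π(x; q, a)` in Cor. 11.17 ff.).
Let `T ≥ 0` with `T(t) ≤ B t` (`t ≥ 2`), let `E ≥ 0` be non-increasing on `[2, ∞)`, `h > 0`,
`|θ₁| ≤ 1`, `1/2 < β ≤ 1`, `A ≥ 0`, and suppose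
`|T(t) − g(t)/h| ≤ A E(t) g(t)/h` for `t ≥ y ≥ 2`, where `g(t) = t − θ₁ t^β/β`.  If
`P = T(x)/log x + ∫₂ˣ T(t) dt/(t log² t)` (partial summation) and `x ≥ max(256, y²)`, then with
`G(x) = Li(x) − θ₁ Li(x^β)`:
`|P − G(x)/h| ≤ 30 A E(√x) G(x)/h + (3B + 19/h) √x`.
[cite: ThornerZaman2019, proof of Thm. 5.1, (5.2)–(5.3)] -/
theorem abs_sub_exceptionalLiMain_le {T E : ℝ → ℝ} {P h θ₁ β A B y x : ℝ}
    (hh : 0 < h) (hθ : |θ₁| ≤ 1) (hβ : 1 / 2 < β) (hβ1 : β ≤ 1) (hA : 0 ≤ A) (hB : 0 ≤ B)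
    (hy : 2 ≤ y) (hT0 : ∀ t, 2 ≤ t → 0 ≤ T t) (hTB : ∀ t, 2 ≤ t → T t ≤ B * t)
    (hE : AntitoneOn E (Ici 2)) (hE0 : ∀ t, 2 ≤ t → 0 ≤ E t)
    (hTE : ∀ t, y ≤ t →
      |T t - (t - θ₁ * t ^ β / β) / h| ≤ A * E t * ((t - θ₁ * t ^ β / β) / h))
    (hx : 256 ≤ x) (hxy : y ^ 2 ≤ x)
    (hTint : IntervalIntegrable (fun t ↦ T t / (t * Real.log t ^ 2)) volume 2 x)
    (hP : P = T x / Real.log x + ∫ t in (2 : ℝ)..x, T t / (t * Real.log t ^ 2)) :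
    |P - (offsetLogIntegral x - θ₁ * offsetLogIntegral (x ^ β)) / h| ≤
      30 * A * E (Real.sqrt x) * ((offsetLogIntegral x - θ₁ * offsetLogIntegral (x ^ β)) / h) +
        (3 * B + 19 / h) * Real.sqrt x := by
  -- notation and basic facts
  set L : ℝ := Real.log x with hLdef
  set s : ℝ := Real.sqrt x with hsdef
  set G : ℝ := offsetLogIntegral x - θ₁ * offsetLogIntegral (x ^ β) with hGdef
  set κ : ℝ := (2 : ℝ) ^ β / (β * Real.log 2) - offsetLogIntegral ((2 : ℝ) ^ β) with hκdef
  have hβ0 : 0 < β := by linarith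
  have hx2 : (2 : ℝ) ≤ x := by linarith
  have hx1 : (1 : ℝ) < x := by linarith
  have hx0 : (0 : ℝ) < x := by linarith
  have hlog2 : (0.6931471803 : ℝ) < Real.log 2 := Real.log_two_gt_d9
  have hl2 : 0 < Real.log 2 := by linarith
  have hL1 : 1 ≤ L := by
    rw [hLdef, Real.le_log_iff_exp_le hx0]
    have he : Real.exp 1 < 2.7182818286 := Real.exp_one_lt_d9
    linarith
  have hL : 0 < L := by linarith
  have hs16 : 16 ≤ s := by
    rw [hsdef, show (16 : ℝ) = Real.sqrt 256 by
      rw [show (256 : ℝ) = 16 ^ 2 by norm_num, Real.sqrt_sq (by norm_num)]]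
    exact Real.sqrt_le_sqrt hx
  have hs2 : 2 ≤ s := by linarith
  have hys : y ≤ s := by
    rw [hsdef, show y = Real.sqrt (y ^ 2) from (Real.sqrt_sq (by linarith)).symm]
    exact Real.sqrt_le_sqrt hxy
  have hss : s * s = x := Real.mul_self_sqrt hx0.le
  have hsx : s ≤ x := by rw [← hss]; exact le_mul_of_one_le_right (by linarith) (by linarith)
  have hlogs : Real.log s = L / 2 := by rw [hsdef, Real.log_sqrt hx0.le]
  have hκ0 : 0 ≤ κ := secondaryTerm_const_nonneg hβ0 hβ1
  have hκ9 : κ ≤ 9 := secondaryTerm_const_le hβ hβ1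
  obtain ⟨hθl, hθu⟩ := abs_le.mp hθ
  -- comparison of the main terms
  obtain ⟨w, hw0, hgw, hxw⟩ := exists_exceptionalMainTerm_le hθ hβ hβ1 hx
  have hG0 : 0 ≤ G := by
    refine le_of_mul_le_mul_left ?_ (by positivity : (0 : ℝ) < 6 * Real.log x)
    rw [mul_zero]
    exact (mul_nonneg hx0.le hw0).trans hxw
  have hE2s : E s ≤ E s := le_rfl
  have hExs : E x ≤ E s := hE (show (2 : ℝ) ≤ s from hs2) (show (2 : ℝ) ≤ x from hx2) hsx
  have hEs0 : 0 ≤ E s := hE0 s hs2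
  have hAE : 0 ≤ A * E s := mul_nonneg hA hEs0
  -- integrability
  have hint1 : IntervalIntegrable (fun t : ℝ ↦ 1 / Real.log t ^ 2) volume 2 x :=
    Chebyshev.intervalIntegrable_one_div_log_sq one_lt_two hx1
  have hint2 : IntervalIntegrable (fun t : ℝ ↦ t ^ β / β / (t * Real.log t ^ 2)) volume 2 x :=
    intervalIntegrable_secondaryIntegrand β one_lt_two hx1
  have hgint : ∀ {a b : ℝ}, 1 < a → 1 < b →
      IntervalIntegrable (fun t : ℝ ↦ (t - θ₁ * t ^ β / β) / h / (t * Real.log t ^ 2)) volume a b := by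
    intro a b ha hb
    refine ContinuousOn.intervalIntegrable fun t ht ↦
      (continuousAt_exceptionalMainTerm_div θ₁ β h ?_).continuousWithinAt
    rcases Set.mem_uIcc.mp ht with h' | h' <;> linarith [h'.1]
  -- the integral of the `g`-part
  have hIg : ∫ t in (2 : ℝ)..x, (t - θ₁ * t ^ β / β) / h / (t * Real.log t ^ 2) =
      h⁻¹ * ((∫ t in (2 : ℝ)..x, 1 / Real.log t ^ 2) -
        θ₁ * ∫ t in (2 : ℝ)..x, t ^ β / β / (t * Real.log t ^ 2)) := by
    rw [← intervalIntegral.integral_const_mul, ← intervalIntegral.integral_sub hint1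
      (hint2.const_mul θ₁), ← intervalIntegral.integral_const_mul]
    refine intervalIntegral.integral_congr fun t ht ↦ ?_
    rw [Set.uIcc_of_le hx2] at ht
    have ht0 : t ≠ 0 := by linarith [ht.1]
    have hlt : Real.log t ≠ 0 :=
      Real.log_ne_zero_of_pos_of_ne_one (by linarith [ht.1]) (by linarith [ht.1])
    field_simp
  -- the decomposition `P − G/h = (T x − g x/h)/L + ∫₂ˣ F + κ'/h`
  have hmain := NumberField.offsetLogIntegral_eq_div_log_add_integral hx2
  have hsec := secondaryTerm_eq_offsetLogIntegral_add hβ0 hx2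
  have hdecomp : P - G / h = (T x - (x - θ₁ * x ^ β / β) / h) / L +
      (∫ t in (2 : ℝ)..x, (T t / (t * Real.log t ^ 2) -
        (t - θ₁ * t ^ β / β) / h / (t * Real.log t ^ 2))) +
      (2 / Real.log 2 - θ₁ * κ) / h := by
    have hsec' : offsetLogIntegral (x ^ β) =
        x ^ β / (β * L) + (∫ t in (2 : ℝ)..x, t ^ β / β / (t * Real.log t ^ 2)) - κ := by
      rw [hκdef]; linarith
    rw [intervalIntegral.integral_sub hTint (hgint one_lt_two hx1), hIg, hP, hGdef, hmain, hsec',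
      ← hLdef]
    set I1 : ℝ := ∫ t in (2 : ℝ)..x, 1 / Real.log t ^ 2 with hI1def
    set I2 : ℝ := ∫ t in (2 : ℝ)..x, t ^ β / β / (t * Real.log t ^ 2) with hI2def
    set IT : ℝ := ∫ t in (2 : ℝ)..x, T t / (t * Real.log t ^ 2) with hITdef
    field_simp
    ring
  -- (a) the boundary term
  have hx8 : (8 : ℝ) ≤ x := by linarith only [hx]
  have hgx0 : 0 ≤ x - θ₁ * x ^ β / β := exceptionalMainTerm_nonneg hθ hβ hβ1 hx8
  have hgxw : x - θ₁ * x ^ β / β ≤ w * x := hgw x ⟨hx1.le, le_rfl⟩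
  have hbd : |(T x - (x - θ₁ * x ^ β / β) / h) / L| ≤ 6 * A * E s * (G / h) := by
    rw [abs_div, abs_of_pos hL, div_le_iff₀ hL]
    calc |T x - (x - θ₁ * x ^ β / β) / h|
        ≤ A * E x * ((x - θ₁ * x ^ β / β) / h) := hTE x (hys.trans hsx)
      _ ≤ A * E s * ((w * x) / h) := by
          refine mul_le_mul (mul_le_mul_of_nonneg_left hExs hA)
            (div_le_div_of_nonneg_right hgxw hh.le) (div_nonneg hgx0 hh.le) hAE
      _ ≤ A * E s * (6 * L * G / h) := by
          refine mul_le_mul_of_nonneg_left (div_le_div_of_nonneg_right ?_ hh.le) hAE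
          linarith only [hxw, hLdef, hGdef, mul_comm x w]
      _ = 6 * A * E s * (G / h) * L := by ring
  -- (b) the integral over `[2, √x]`
  set F : ℝ → ℝ := fun t ↦ T t / (t * Real.log t ^ 2) -
      (t - θ₁ * t ^ β / β) / h / (t * Real.log t ^ 2) with hFdef
  have hFint : ∀ {a b : ℝ}, 2 ≤ a → b ≤ x → a ≤ b → IntervalIntegrable F volume a b := by
    intro a b ha hb hab
    refine (hTint.sub (hgint one_lt_two hx1)).mono_set ?_
    rw [Set.uIcc_of_le hx2, Set.uIcc_of_le hab]
    exact Set.Icc_subset_Icc ha hb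
  have hFabs : ∀ t, 2 ≤ t → |F t| = |T t - (t - θ₁ * t ^ β / β) / h| / (t * Real.log t ^ 2) := by
    intro t ht
    have hpos : 0 < t * Real.log t ^ 2 := by
      have := Real.log_pos (by linarith : (1 : ℝ) < t); positivity
    rw [hFdef]
    dsimp only
    rw [← sub_div, abs_div, abs_of_pos hpos]
  have hB3 : 0 ≤ B + 3 / h := add_nonneg hB (div_nonneg (by norm_num) hh.le)
  have hI1 : |∫ t in (2 : ℝ)..s, F t| ≤ (B + 3 / h) * (21 / 10 * s) := by
    have hbound : ∀ᵐ t : ℝ, t ∈ Ioc 2 s → ‖F t‖ ≤ (B + 3 / h) * (1 / Real.log t ^ 2) := by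
      refine Filter.Eventually.of_forall fun t ht ↦ ?_
      have ht2 : 2 ≤ t := ht.1.le
      have ht0 : 0 < t := by linarith
      have hlt : 0 < Real.log t := Real.log_pos (by linarith)
      rw [Real.norm_eq_abs, hFabs t ht2, div_le_iff₀ (by positivity)]
      calc |T t - (t - θ₁ * t ^ β / β) / h| ≤ |T t| + |(t - θ₁ * t ^ β / β) / h| := abs_sub _ _
        _ ≤ B * t + 3 * t / h := by
            refine add_le_add ?_ ?_
            · rw [abs_of_nonneg (hT0 t ht2)]; exact hTB t ht2
            · rw [abs_div, abs_of_pos hh]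
              exact div_le_div_of_nonneg_right
                (abs_exceptionalMainTerm_le hθ hβ hβ1 (by linarith)) hh.le
        _ = (B + 3 / h) * (1 / Real.log t ^ 2) * (t * Real.log t ^ 2) := by
            field_simp
    calc |∫ t in (2 : ℝ)..s, F t| ≤ ∫ t in (2 : ℝ)..s, (B + 3 / h) * (1 / Real.log t ^ 2) :=
          intervalIntegral.norm_integral_le_of_norm_le hs2 hbound
            ((Chebyshev.intervalIntegrable_one_div_log_sq one_lt_two (by linarith)).const_mul _)
      _ = (B + 3 / h) * ∫ t in (2 : ℝ)..s, 1 / Real.log t ^ 2 :=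
          intervalIntegral.integral_const_mul _ _
      _ ≤ (B + 3 / h) * ((s - 2) / Real.log 2 ^ 2) :=
          mul_le_mul_of_nonneg_left (integral_one_div_log_sq_le one_lt_two hs2) hB3
      _ ≤ (B + 3 / h) * (21 / 10 * s) := by
          refine mul_le_mul_of_nonneg_left ?_ hB3
          rw [div_le_iff₀ (pow_pos hl2 2)]
          exact sub_two_le_mul_log_two_sq (by linarith)
  -- (c) the integral over `[√x, x]`
  have hI2 : |∫ t in s..x, F t| ≤ 24 * A * E s * (G / h) := by
    have hbound : ∀ᵐ t : ℝ, t ∈ Ioc s x → ‖F t‖ ≤ (A * E s * w / h) * (1 / Real.log t ^ 2) := by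
      refine Filter.Eventually.of_forall fun t ht ↦ ?_
      have hts : s ≤ t := ht.1.le
      have ht2 : 2 ≤ t := hs2.trans hts
      have ht0 : 0 < t := by linarith
      have hlt : 0 < Real.log t := Real.log_pos (by linarith)
      have hgt0 : 0 ≤ t - θ₁ * t ^ β / β := exceptionalMainTerm_nonneg hθ hβ hβ1 (by linarith)
      have hgtw : t - θ₁ * t ^ β / β ≤ w * t := hgw t ⟨by linarith, ht.2⟩
      have hEts : E t ≤ E s := hE (show (2 : ℝ) ≤ s from hs2) (show (2 : ℝ) ≤ t from ht2) hts
      rw [Real.norm_eq_abs, hFabs t ht2, div_le_iff₀ (by positivity)]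
      calc |T t - (t - θ₁ * t ^ β / β) / h|
          ≤ A * E t * ((t - θ₁ * t ^ β / β) / h) := hTE t (hys.trans hts)
        _ ≤ A * E s * ((w * t) / h) :=
            mul_le_mul (mul_le_mul_of_nonneg_left hEts hA)
              (div_le_div_of_nonneg_right hgtw hh.le) (div_nonneg hgt0 hh.le) hAE
        _ = A * E s * w / h * (1 / Real.log t ^ 2) * (t * Real.log t ^ 2) := by
            field_simp
    calc |∫ t in s..x, F t| ≤ ∫ t in s..x, (A * E s * w / h) * (1 / Real.log t ^ 2) :=
          intervalIntegral.norm_integral_le_of_norm_le hsx hbound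
            ((Chebyshev.intervalIntegrable_one_div_log_sq (by linarith) hx1).const_mul _)
      _ = (A * E s * w / h) * ∫ t in s..x, 1 / Real.log t ^ 2 :=
          intervalIntegral.integral_const_mul _ _
      _ ≤ (A * E s * w / h) * ((x - s) / Real.log s ^ 2) :=
          mul_le_mul_of_nonneg_left (integral_one_div_log_sq_le (by linarith) hsx)
            (div_nonneg (mul_nonneg hAE hw0) hh.le)
      _ ≤ (A * E s * w / h) * (4 * x / L ^ 2) := by
          refine mul_le_mul_of_nonneg_left ?_ (div_nonneg (mul_nonneg hAE hw0) hh.le)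
          rw [hlogs, show (L / 2) ^ 2 = L ^ 2 / 4 by ring, div_div_eq_mul_div]
          refine div_le_div_of_nonneg_right ?_ (sq_nonneg L)
          linarith only [hs2]
      _ = A * E s / h * (4 / L ^ 2) * (x * w) := by
          field_simp
      _ ≤ A * E s / h * (4 / L ^ 2) * (6 * L * G) :=
          mul_le_mul_of_nonneg_left hxw (by positivity)
      _ = 24 * A * E s * (G / h) * (1 / L) := by
          field_simp
          ring
      _ ≤ 24 * A * E s * (G / h) * 1 := by
          refine mul_le_mul_of_nonneg_left ?_ (by positivity)
          rw [div_le_one hL]; exact hL1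
      _ = 24 * A * E s * (G / h) := mul_one _
  -- (d) the constant
  have hconst : |(2 / Real.log 2 - θ₁ * κ) / h| ≤ 12 / h := by
    rw [abs_div, abs_of_pos hh, div_le_div_iff_of_pos_right hh]
    have h22 : 2 / Real.log 2 ≤ 3 := by
      rw [div_le_iff₀ hl2]; linarith only [hlog2]
    have h20 : 0 ≤ 2 / Real.log 2 := by positivity
    have hθκ : |θ₁ * κ| ≤ 9 := by
      rw [abs_mul, abs_of_nonneg hκ0]
      calc |θ₁| * κ ≤ 1 * 9 := mul_le_mul hθ hκ9 hκ0 zero_le_one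
        _ = 9 := one_mul 9
    calc |2 / Real.log 2 - θ₁ * κ| ≤ |2 / Real.log 2| + |θ₁ * κ| := abs_sub _ _
      _ ≤ 3 + 9 := add_le_add (by rwa [abs_of_nonneg h20]) hθκ
      _ = 12 := by norm_num
  -- assembly
  have hsplit : ∫ t in (2 : ℝ)..x, F t = (∫ t in (2 : ℝ)..s, F t) + ∫ t in s..x, F t :=
    (intervalIntegral.integral_add_adjacent_intervals (hFint le_rfl hsx hs2)
      (hFint hs2 le_rfl hsx)).symm
  have hs1 : 1 ≤ s := by linarith only [hs16]
  have h12 : 12 / h ≤ 12 / h * s := le_mul_of_one_le_right (by positivity) hs1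
  rw [hdecomp]
  calc |(T x - (x - θ₁ * x ^ β / β) / h) / L + (∫ t in (2 : ℝ)..x, F t) +
          (2 / Real.log 2 - θ₁ * κ) / h|
      ≤ |(T x - (x - θ₁ * x ^ β / β) / h) / L| + |∫ t in (2 : ℝ)..x, F t| +
          |(2 / Real.log 2 - θ₁ * κ) / h| := abs_add_three _ _ _
    _ ≤ 6 * A * E s * (G / h) + ((B + 3 / h) * (21 / 10 * s) + 24 * A * E s * (G / h)) + 12 / h := by
        refine add_le_add_three hbd ?_ hconst
        rw [hsplit]
        exact (abs_add_le _ _).trans (add_le_add hI1 hI2)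
    _ ≤ 30 * A * E s * (G / h) + (3 * B + 19 / h) * s := by
        linarith only [junk_terms_le hB hh hs1]

end Literature.NumberTheory.LFunctions

end
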